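import Summits.Ventures.PercRepro.C041TriDomDominationClass

/-!
# ROW C-041 — CONJECTURE (STOCHASTIC DOMINATION) ON SEPARABLE HOSTS
(p6, gen 44; P6-TWOEXIT-LEAN.md §53 ADDENDUM 15, part II of II)

**THEOREM (STOCHASTIC DOMINATION ON SEPARABLE HOSTS)** (`cycDomination_of_separable`): on a separable host — the
marks not all connected, or one mark a cut vertex between the other two, coincidences included — the up-set form
`CycDomination` of the conjecture holds.  PROOF: with the marks not all connected every crossed class is empty
(each needs two pairs connected in some colour); with two coincident marks every class is empty (each class has,
at every coordinate, a pattern with `false` there, `not_cycCrossed_of_coinc`); with a separating mark two of the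
three classes are empty (a walk between the separated marks passes through the separating one, `rtg_through` of
`C041TriDomExcessZeroSide` — `RdS_through_of_sep` / `MgS_through_of_sep`) and the third is dominated by part I.
So the conjecture is open exactly on the hosts with `e ≥ 1` (THEOREM (EQUALITY CASE)); by THE MONOTONE INJECTION
LEMMA the red-ward injection exists on every separable host (`exists_injection_of_separable`).
-/

namespace PercRepro

namespace ZoneZ

namespace MultiExit

open ZoneData Finset

variable {V₁ E₁ U₁ U₂ : Type} (Z₁ : ZoneData V₁ E₁ U₁ U₂) (u u' a₁ : V₁)

variable [Fintype E₁] [DecidableEq E₁]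

/-! ## Separable hosts: two classes are empty -/

omit [Fintype E₁] [DecidableEq E₁] in
/-- A red walk between two marks separated by the third passes through it. -/
theorem RdS_through_of_sep {a b c : V₁} (hca : c ≠ a) (hsep : b ∉ side Z₁ (fun _ => EStat.free) a c)
    {ω : E₁ → Bool} (h : RdS Z₁ (fun _ => EStat.free) ω b c) : RdS Z₁ (fun _ => EStat.free) ω b a := by
  unfold RdS at h ⊢
  rw [mem_reach_singleton] at h ⊢
  rw [RAdjS_eq_AdjCol] at h ⊢
  have hc : c ∈ side Z₁ (fun _ => EStat.free) a c := mem_reach_self _ _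
  exact (rtg_through Z₁ hca (fun e he => redE_pres he) hsep h hc).1

omit [Fintype E₁] [DecidableEq E₁] in
/-- A blue walk between two marks separated by the third passes through it. -/
theorem MgS_through_of_sep {a b c : V₁} (hca : c ≠ a) (hsep : b ∉ side Z₁ (fun _ => EStat.free) a c)
    {ω : E₁ → Bool} (h : MgS Z₁ (fun _ => EStat.free) ω b c) : MgS Z₁ (fun _ => EStat.free) ω b a := by
  unfold MgS at h ⊢
  rw [mem_reach_singleton] at h ⊢
  rw [BAdjS_eq_AdjCol] at h ⊢
  have hc : c ∈ side Z₁ (fun _ => EStat.free) a c := mem_reach_self _ _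
  exact (rtg_through Z₁ hca (fun e he => blueE_pres he) hsep h hc).1

omit [Fintype E₁] [DecidableEq E₁] in
/-- With two coincident marks no colouring is crossed: each class has, at every coordinate, a pattern with a
`false` there, while coincident marks are connected in both colours. -/
theorem not_cycCrossed_of_coinc (h : a₁ = u ∨ a₁ = u' ∨ u = u') (ω : E₁ → Bool) :
    ¬ CycCrossed Z₁ a₁ u u' ω := by
  intro hc
  unfold CycCrossed at hc
  rcases hc with ⟨hr, hb⟩ | ⟨hr, hb⟩ | ⟨hr, hb⟩ <;> rw [rsig_eq_iff] at hr <;> rw [bsig_eq_iff] at hb <;>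
    simp only [iff_true, Bool.false_eq_true, iff_false] at hr hb <;> rcases h with rfl | rfl | rfl
  · exact hb.1 (mem_reach_self _ _)
  · exact hr.2.1 (mem_reach_self _ _)
  · exact hr.2.2 (mem_reach_self _ _)
  · exact hr.1 (mem_reach_self _ _)
  · exact hb.2.1 (mem_reach_self _ _)
  · exact hr.2.2 (mem_reach_self _ _)
  · exact hr.1 (mem_reach_self _ _)
  · exact hr.2.1 (mem_reach_self _ _)
  · exact hb.2.2 (mem_reach_self _ _)

open Classical in
/-- The count of the crossed classes inside `V` is at most the count of one class `C` when the other two are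
empty on `V`. -/
theorem card_cycCrossed_le_of_two_empty (C : (E₁ → Bool) → Prop) {V : (E₁ → Bool) → Prop}
    (h : ∀ ω, V ω → CycCrossed Z₁ a₁ u u' ω → C ω) :
    (univ.filter fun ω : E₁ → Bool => V ω ∧ CycCrossed Z₁ a₁ u u' ω).card ≤
      (univ.filter fun ω : E₁ → Bool => V ω ∧ C ω).card := by
  refine Finset.card_le_card fun ω hω => ?_
  obtain ⟨hu, hV, hc⟩ := Finset.mem_filter.mp hω
  exact Finset.mem_filter.mpr ⟨hu, hV, h ω hV hc⟩

open Classical in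
/-- With two coincident marks the conjecture holds trivially. -/
theorem cycDomination_of_coinc (h : a₁ = u ∨ a₁ = u' ∨ u = u') : CycDomination Z₁ a₁ u u' := by
  intro V _
  refine le_trans (card_cycCrossed_le_of_two_empty Z₁ u u' a₁ (fun _ => False) fun ω _ hc =>
    not_cycCrossed_of_coinc Z₁ u u' a₁ h ω hc) ?_
  simp

open Classical in
/-- **THEOREM (STOCHASTIC DOMINATION ON SEPARABLE HOSTS)**: on a host whose marks are not all connected, or one of
which separates the other two (coincidences included), the up-set form of CONJECTURE (STOCHASTIC DOMINATION)
holds. -/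
theorem cycDomination_of_separable (h : SeparableS Z₁ u u' a₁ (fun _ => EStat.free)) :
    CycDomination Z₁ a₁ u u' := by
  rcases h with h | h | h | h
  · -- not all connected: every crossed class is empty
    intro V _
    refine le_trans (card_cycCrossed_le_of_two_empty Z₁ u u' a₁ (fun _ => False) fun ω _ hc => ?_) ?_
    · exfalso
      apply h
      unfold CycCrossed at hc
      rcases hc with ⟨hr, hb⟩ | ⟨hr, hb⟩ | ⟨hr, hb⟩ <;> rw [rsig_eq_iff] at hr <;> rw [bsig_eq_iff] at hb <;>
        simp only [iff_true, Bool.false_eq_true, iff_false] at hr hb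
      · exact ⟨RdS_pconn Z₁ hr.1, MgS_pconn Z₁ hb.2.1⟩
      · exact ⟨PConn_trans Z₁ (RdS_pconn Z₁ hr.2.1) (PConn_symm Z₁ (MgS_pconn Z₁ hb.2.2)), RdS_pconn Z₁ hr.2.1⟩
      · exact ⟨MgS_pconn Z₁ hb.1, PConn_trans Z₁ (MgS_pconn Z₁ hb.1) (RdS_pconn Z₁ hr.2.2)⟩
    · simp
  · -- `a₁` separates `u` from `u'`: only `(s₁,s₂)` survives
    unfold SepS at h
    rcases h with h | h | hside
    · exact cycDomination_of_coinc Z₁ u u' a₁ (Or.inl h.symm)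
    · exact cycDomination_of_coinc Z₁ u u' a₁ (Or.inr (Or.inl h.symm))
    intro V hV
    by_cases hu'a : u' = a₁
    · exact cycDomination_of_coinc Z₁ u u' a₁ (Or.inr (Or.inl hu'a.symm)) V hV
    refine le_trans (card_cycCrossed_le_of_two_empty Z₁ u u' a₁
      (fun ω => rsig Z₁ u u' a₁ (fun _ => EStat.free) ω = (true, false, false) ∧
        bsig Z₁ u u' a₁ (fun _ => EStat.free) ω = (false, true, false)) fun ω _ hc => ?_) ?_
    swap
    · convert class12_le_topBot Z₁ u u' a₁ hV
      rfl
    unfold CycCrossed at hc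
    rcases hc with hc | ⟨hr, hb⟩ | ⟨hr, hb⟩
    · exact hc
    · exfalso
      rw [rsig_eq_iff] at hr
      rw [bsig_eq_iff] at hb
      simp only [iff_true, Bool.false_eq_true, iff_false] at hr hb
      exact hb.1 (MgS_symm' Z₁ (MgS_through_of_sep Z₁ hu'a hside hb.2.2))
    · exfalso
      rw [rsig_eq_iff] at hr
      rw [bsig_eq_iff] at hb
      simp only [iff_true, Bool.false_eq_true, iff_false] at hr hb
      exact hr.1 (RdS_symm' Z₁ (RdS_through_of_sep Z₁ hu'a hside hr.2.2))
  · -- `u` separates `a₁` from `u'`: only `(s₃,s₁)` survives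
    unfold SepS at h
    rcases h with h | h | hside
    · exact cycDomination_of_coinc Z₁ u u' a₁ (Or.inl h)
    · exact cycDomination_of_coinc Z₁ u u' a₁ (Or.inr (Or.inr h.symm))
    intro V hV
    by_cases hu'u : u' = u
    · exact cycDomination_of_coinc Z₁ u u' a₁ (Or.inr (Or.inr hu'u.symm)) V hV
    refine le_trans (card_cycCrossed_le_of_two_empty Z₁ u u' a₁
      (fun ω => rsig Z₁ u u' a₁ (fun _ => EStat.free) ω = (false, false, true) ∧
        bsig Z₁ u u' a₁ (fun _ => EStat.free) ω = (true, false, false)) fun ω _ hc => ?_) ?_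
    swap
    · convert class31_le_topBot Z₁ u u' a₁ hV
      rfl
    unfold CycCrossed at hc
    rcases hc with ⟨hr, hb⟩ | ⟨hr, hb⟩ | hc
    · exfalso
      rw [rsig_eq_iff] at hr
      rw [bsig_eq_iff] at hb
      simp only [iff_true, Bool.false_eq_true, iff_false] at hr hb
      exact hb.1 (MgS_through_of_sep Z₁ hu'u hside hb.2.1)
    · exfalso
      rw [rsig_eq_iff] at hr
      rw [bsig_eq_iff] at hb
      simp only [iff_true, Bool.false_eq_true, iff_false] at hr hb
      exact hr.1 (RdS_through_of_sep Z₁ hu'u hside hr.2.1)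
    · exact hc
  · -- `u'` separates `a₁` from `u`: only `(s₂,s₃)` survives
    unfold SepS at h
    rcases h with h | h | hside
    · exact cycDomination_of_coinc Z₁ u u' a₁ (Or.inr (Or.inl h))
    · exact cycDomination_of_coinc Z₁ u u' a₁ (Or.inr (Or.inr h))
    intro V hV
    by_cases huu' : u = u'
    · exact cycDomination_of_coinc Z₁ u u' a₁ (Or.inr (Or.inr huu')) V hV
    refine le_trans (card_cycCrossed_le_of_two_empty Z₁ u u' a₁
      (fun ω => rsig Z₁ u u' a₁ (fun _ => EStat.free) ω = (false, true, false) ∧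
        bsig Z₁ u u' a₁ (fun _ => EStat.free) ω = (false, false, true)) fun ω _ hc => ?_) ?_
    swap
    · convert class23_le_topBot Z₁ u u' a₁ hV
      rfl
    unfold CycCrossed at hc
    rcases hc with ⟨hr, hb⟩ | hc | ⟨hr, hb⟩
    · exfalso
      rw [rsig_eq_iff] at hr
      rw [bsig_eq_iff] at hb
      simp only [iff_true, Bool.false_eq_true, iff_false] at hr hb
      exact hr.2.1 (RdS_through_of_sep Z₁ huu' hside hr.1)
    · exact hc
    · exfalso
      rw [rsig_eq_iff] at hr
      rw [bsig_eq_iff] at hb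
      simp only [iff_true, Bool.false_eq_true, iff_false] at hr hb
      exact hb.2.1 (MgS_through_of_sep Z₁ huu' hside hb.1)

open Classical in
/-- On a separable host the red-ward injection of the crossed classes into `(⊤,⊥)` exists. -/
theorem exists_injection_of_separable (h : SeparableS Z₁ u u' a₁ (fun _ => EStat.free)) :
    ∃ φ : (E₁ → Bool) → (E₁ → Bool), Set.InjOn φ {ω | CycCrossed Z₁ a₁ u u' ω} ∧
      ∀ ω, CycCrossed Z₁ a₁ u u' ω → TopBot Z₁ a₁ u u' (φ ω) ∧ LeCol ω (φ ω) :=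
  (cycDomination_iff_injection Z₁ a₁ u u').1 (cycDomination_of_separable Z₁ u u' a₁ h)

end MultiExit

end ZoneZ

end PercRepro
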